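import Summits.Schanuel.Schanuel.Theorems.RootDecomp1KXLinearII03

/-!
# RootDecomp1KXTop — lens 1, generation 45, node 4 (g45d) «SIMPLE POINTS OVER x = ∞, ALL x-DEGREES k, THE POINT (∞,∞) OF ANY ORDER e INCLUDED» (RULE K-R33 (iii); CLAIM L2301, ACK/price L2304, NODE L2313; critic VERDICT pending at staging — filed only on GO, behind XLinearII03) — continuation (RootDecomp1KXTop01): §XIII part 1

(lens-1 g45d HOME kernel K₄ = HOME/decomp-schanuel-lens-1/g45d/DLxtop.lean 5099 l = K₃ (tree: DegreeLadder + XLinear + XLinearII parts) + §XIII xiii_tail.lean 617 l (ns `…RootDecomp1KXTop`). Port by census-1 gen 19 as `RootDecomp1KXTop01–03` importing tree XLinearII03: the curves P = Σ_{j≤k} x^j c_j(Y) with separable top coefficient of maximal Y-degree (simple points over x = ∞) and the point (∞,∞) of any order e — `thinFibreAt_xPoly (k) (c) (e) …`, `thinFibreAt_xTop`, `thinFibreAt_xPoly_two`, `thinFibreAt_xLinear_sep_again`, `thinFibreAt_family`, positions (`mixed_not_affine`, `contact_not_*`) — ALL HYPOTHESIS-FREE (Ridout for rationals via the tree's XLinearII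 `ridout_window`, itself fed by `Ridout.finite_of_abs_le_one`).
PORT EDITS: the `(hR : PadicRothRat)` binder REMOVED from the five decls that carried it (the XLinearII port deleted `PadicRothRat`; `ridout_window`/`thinFibreAt_xPoly`/`thinFibreAt_xTop` are fed without it); `open …XLinearCore (norm_two …)` ↦ unrestricted open + private copies; linter option dropped; five docstrings added; statements and proofs otherwise verbatim. `--supports stmt-Schanuel-33364`; no census credit; rung 0.)
-/

noncomputable section

namespace Summit.Schanuel.Schanuel.Theorems.RootDecomp1KXTop

open Polynomial LiouvilleNumber
open scoped Nat
open Summit.Schanuel.Schanuel.Theorems.RootDecomp1KSkelCell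
  (exists_le_two_pow_factorial iota iota_spec iota_le_of_le pow_lt_of_lt_iota lt_iota_of_pow_lt iota_mono
   one_le_iota SkelLiouville SkelLiouvilleFix skelLiouville_iff_fix SkelLiouvilleFix.mono uStar dU rU dU_cast
   two_pow_le_four_mul_dU two_mul_dU_lt one_le_dU rU_den rU_cast uStar_sub_rU skelLiouvilleFix_one_uStar
   not_skelFixOne_algebraicIndependent)
open Summit.Schanuel.Schanuel.Theorems.RootDecomp1KTwoBaseCell (psNumer partialSum_eq_psNumer_div coprime_psNumer
  algebraicIndependent_of_forall_int')
open Summit.Schanuel.Schanuel.Theorems.RootDecomp1KRelLiouvilleCell (partialSum_two_strictMono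
  partialSum_two_lt_liouvilleNumber abs_liouvilleNumber_two_sub_partialSum)
open Summit.Schanuel.Schanuel.Theorems.RootDecomp1KDegreeLadder
open Summit.Schanuel.Schanuel.Theorems.RootDecomp1KXLinearCore
open Summit.Schanuel.Schanuel.Theorems.RootDecomp1KXLinear
open Summit.Schanuel.Schanuel.Theorems.RootDecomp1KXLinearII

/-- `s_N = p_N / 2^{N!}` (tree `partialSum_eq_psNumer_div` at `b = 2`). -/
private theorem partialSum_two (N : ℕ) : partialSum 2 N = (psNumer 2 N : ℝ) / (2 : ℝ) ^ N ! := by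
  have := partialSum_eq_psNumer_div (b := 2) (by norm_num) N
  simpa using this

/-- `‖2‖₂ = 1/2` in `PadicAlgCl 2`. -/
private theorem norm_two : ‖(2 : PadicAlgCl 2)‖ = 1 / 2 := by
  have h1 : ((2 : ℕ) : PadicAlgCl 2) = algebraMap ℚ_[2] (PadicAlgCl 2) ((2 : ℕ) : ℚ_[2]) :=
    (map_natCast _ 2).symm
  have h2 : ‖((2 : ℕ) : ℚ_[2])‖ = (↑(2 : ℕ) : ℝ)⁻¹ := Padic.norm_p
  have h3 : ‖((2 : ℕ) : PadicAlgCl 2)‖ = 1 / 2 := by rw [h1, PadicAlgCl.norm_extends, h2]; norm_num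
  simpa using h3

/-- `‖2^t‖₂ = 2^{−t}`. -/
private theorem norm_two_pow (t : ℕ) : ‖(2 : PadicAlgCl 2) ^ t‖ = (1 / 2 : ℝ) ^ t := by
  rw [norm_pow, norm_two]

/-- `‖(z : \overline{ℚ₂})‖ ≤ 1` for integers. -/
private theorem norm_intCast_le_one' (z : ℤ) : ‖(z : PadicAlgCl 2)‖ ≤ 1 := by
  have h1 : (z : PadicAlgCl 2) = algebraMap ℚ_[2] (PadicAlgCl 2) (z : ℚ_[2]) := (map_intCast _ z).symm
  rw [h1, PadicAlgCl.norm_extends]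
  exact Padic.norm_int_le_one z

/-!
# RootDecomp1K — thin fibres III: SIMPLE FINITE POINTS OVER `x = ∞` (every `x`-degree; lens-1 g45, node 4 = g45d).

For `P = Σ_{j ≤ k} x^j · c_j(Y) ∈ ℤ[x][Y]` whose TOP `x`-coefficient `c_k` is separable over `ℚ` (the FINITE points of
the curve over `x = ∞` are simple) and with `deg c_j ≤ deg c_k + e` (`e` = the order of the point `(∞, ∞)`; `e = 0`:
no such point), the bounded rational points `r` on the level `x = s_N = p_N/2^{N!}` satisfy, by ULTRAMETRIC
DOMINATION of the top power, `‖c_k(r)‖₂ ≤ 2^{−N!} · max(1, ‖r‖₂)^{deg c_k + e}` (`top_coeff_small`).  DICHOTOMY: either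
`‖r‖₂` is bounded — then `r` is `2^{−N!}`-close in `ℂ₂` to a root of `c_k` and the Ridout-for-rationals dichotomy of
§XII applies (`m₀ ≥ 3`) — or `‖r‖₂^e ≥ ‖lc‖·2^{N!}`, i.e. `r` is 2-adically AT the point `(∞, ∞)`, and then
`den(r)^e ≥ ‖lc‖·2^{N!}` DIRECTLY (a 2-adically large rational has a large denominator — no Diophantine input),
which gives the clause for `m₀ ≥ e + 1`.  Result: `ThinFibreAt m₀ P` for every `m₀ ≥ max(3, e + 1)`; for `e ≤ 2`
(in particular for the critic's «all points over `x = ∞` simple in `P¹`», `e ≤ 1`) every `m₀ ≥ 3`.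
Levels per point are finite for an ARBITRARY `P` at a non-degenerate `r` (node-1's `specX`).
`k = 1`, `e = 0` is exactly the x-linear case II of §XII (`xPolyP 1 c = xLinP (c 0) (c 1)`).
-/

/-! ### The class: polynomials in `x` with `Y`-polynomial coefficients -/

/-- `xPolyP k c = Σ_{j ≤ k} x^j · c_j(Y)` (the `c_j ∈ ℤ[Y]` are the `x`-coefficients). -/
def xPolyP (k : ℕ) (c : ℕ → ℤ[X]) : ℤ[X][X] :=
  ∑ j ∈ Finset.range (k + 1), C (X ^ j) * Polynomial.map C (c j)

/-- `bev` of a finite sum. -/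
theorem bev_finset_sum (s : Finset ℕ) (f : ℕ → ℤ[X][X]) (x y : ℝ) :
    bev (∑ j ∈ s, f j) x y = ∑ j ∈ s, bev (f j) x y := by
  unfold bev
  rw [Polynomial.map_sum, eval_finsetSum]

/-- `bev` of the x-polynomial curve `Σ_j x^j c_j(Y)`. -/
@[simp] theorem bev_xPolyP (k : ℕ) (c : ℕ → ℤ[X]) (x y : ℝ) :
    bev (xPolyP k c) x y = ∑ j ∈ Finset.range (k + 1), x ^ j * aeval y (c j) := by
  unfold xPolyP
  rw [bev_finset_sum]
  refine Finset.sum_congr rfl fun j _ => ?_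
  rw [bev_mul, bev_C, bev_map_C, map_pow, aeval_X]

/-- `k = 1` is the x-linear family of §X–§XII. -/
theorem xPolyP_one (c : ℕ → ℤ[X]) : xPolyP 1 c = xLinP (c 0) (c 1) := by
  unfold xPolyP xLinP
  simp [Finset.sum_range_succ]

/-! ### Levels per point, for an ARBITRARY `P` -/

/-- (β) For ANY `P ∈ ℤ[x][Y]`: if `x ↦ q^d·P(x, r)` (node-1's `specX P r ∈ ℤ[x]`) is not the zero polynomial, then `r`
lies on finitely many levels (finitely many real roots; `N ↦ s_N` injective).  No `x`-degree hypothesis. -/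
theorem levels_finite_of_specX_ne_zero (P : ℤ[X][X]) (r : ℚ) (hQ : specX P r ≠ 0) :
    {N : ℕ | bev P (partialSum 2 N) r = 0}.Finite := by
  have hfin : ((specX P r).rootSet ℝ).Finite := rootSet_finite _ _
  refine (Set.Finite.preimage (partialSum_two_strictMono.injective.injOn) hfin).subset ?_
  intro N hN
  show partialSum 2 N ∈ (specX P r).rootSet ℝ
  rw [mem_rootSet]
  refine ⟨hQ, ?_⟩
  have hN' : bev P (partialSum 2 N) r = 0 := hN
  rw [aeval_specX, hN', mul_zero]

/-- a non-degenerate `r` (`∃ x, P(x, r) ≠ 0`) has `specX P r ≠ 0`. -/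
theorem specX_ne_zero_of_nondeg (P : ℤ[X][X]) (r : ℚ) (hnd : ∃ x : ℝ, bev P x r ≠ 0) : specX P r ≠ 0 := by
  obtain ⟨x, hx⟩ := hnd
  intro h0
  have h := aeval_specX P r x
  rw [h0, map_zero] at h
  have hq : (r.den : ℝ) ^ P.natDegree ≠ 0 := pow_ne_zero _ (by exact_mod_cast r.den_nz)
  exact hx ((mul_eq_zero.mp h.symm).resolve_left hq)

/-- (β) A non-degenerate rational `r` lies on finitely many levels of ANY `P ∈ ℤ[x][Y]`. -/
theorem levels_finite_of_nondeg (P : ℤ[X][X]) (r : ℚ) (hnd : ∃ x : ℝ, bev P x r ≠ 0) :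
    {N : ℕ | bev P (partialSum 2 N) r = 0}.Finite :=
  levels_finite_of_specX_ne_zero P r (specX_ne_zero_of_nondeg P r hnd)

/-- (γ) The `Y`-free bottom: all `x`-coefficients constant, `P = g(x)`; finitely many levels carry any non-degenerate
point (those with `g(s_N) = 0`). -/
theorem thinFibreAt_xPolyP_const (k : ℕ) (c : ℕ → ℤ[X]) (h0 : ∀ j, j ≤ k → (c j).natDegree = 0) (m₀ : ℕ) :
    ThinFibreAt m₀ (xPolyP k c) := by
  classical
  have hindep : ∀ (x : ℝ) (y y' : ℝ), bev (xPolyP k c) x y = bev (xPolyP k c) x y' := by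
    intro x y y'
    rw [bev_xPolyP, bev_xPolyP]
    refine Finset.sum_congr rfl fun j hj => ?_
    have hjk : j ≤ k := by have := Finset.mem_range.mp hj; omega
    rw [eq_C_of_natDegree_eq_zero (h0 j hjk), aeval_C, aeval_C]
  intro C
  by_cases hex : ∃ x : ℝ, bev (xPolyP k c) x ((0 : ℚ) : ℝ) ≠ 0
  · obtain ⟨N₀, hN₀⟩ := (levels_finite_of_nondeg (xPolyP k c) 0 hex).bddAbove
    refine ⟨N₀ + 1, fun N hN r _ hP _ => ?_⟩
    exfalso
    have hmem : N ∈ {N : ℕ | bev (xPolyP k c) (partialSum 2 N) ((0 : ℚ) : ℝ) = 0} := by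
      show bev (xPolyP k c) (partialSum 2 N) ((0 : ℚ) : ℝ) = 0
      rw [hindep _ _ (r : ℝ)]; exact hP
    have := hN₀ hmem
    omega
  · refine ⟨0, fun N _ r _ _ hnd => ?_⟩
    exfalso
    obtain ⟨x, hx⟩ := hnd
    exact hex ⟨x, by rw [hindep _ _ (r : ℝ)]; exact hx⟩

/-! ### (α) Ultrametric domination of the top power -/

/-- the level identity in `ℂ₂`, top term isolated: `p_N^k · c_k(r) = −Σ_{j<k} p_N^j 2^{(k−j)N!} c_j(r)`. -/
theorem level_identity (k : ℕ) (c : ℕ → ℤ[X]) (N : ℕ) (r : ℚ) (hP : bev (xPolyP k c) (partialSum 2 N) r = 0) :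
    (psNumer 2 N : PadicAlgCl 2) ^ k * aeval (r : PadicAlgCl 2) (c k) =
      -(∑ j ∈ Finset.range k, (psNumer 2 N : PadicAlgCl 2) ^ j * 2 ^ ((k - j) * N !) *
        aeval (r : PadicAlgCl 2) (c j)) := by
  set p : ℕ := psNumer 2 N with hpdef
  have hq0 : ∑ j ∈ Finset.range (k + 1), ((p : ℚ) / 2 ^ N !) ^ j * aeval r (c j) = 0 := by
    have hcast : ((∑ j ∈ Finset.range (k + 1), ((p : ℚ) / 2 ^ N !) ^ j * aeval r (c j) : ℚ) : ℝ) =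
        bev (xPolyP k c) (partialSum 2 N) r := by
      rw [bev_xPolyP, partialSum_two, Rat.cast_sum]
      refine Finset.sum_congr rfl fun j _ => ?_
      push_cast
      rw [aeval_ratCast, hpdef]
    have h := hcast.trans hP
    exact_mod_cast h
  have hq1 : ∑ j ∈ Finset.range (k + 1), (p : ℚ) ^ j * 2 ^ ((k - j) * N !) * aeval r (c j) = 0 := by
    have h := congrArg (fun w => (2 : ℚ) ^ (k * N !) * w) hq0
    simp only [mul_zero, Finset.mul_sum] at h
    rw [← h]
    refine Finset.sum_congr rfl fun j hj => ?_
    have hjk : j ≤ k := by have := Finset.mem_range.mp hj; omega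
    have h2 : (2 : ℚ) ^ (k * N !) = 2 ^ ((k - j) * N !) * 2 ^ (N ! * j) := by
      rw [← pow_add]; congr 1
      have : (k - j) * N ! + N ! * j = k * N ! := by
        rw [mul_comm (N !) j, ← add_mul, Nat.sub_add_cancel hjk]
      omega
    have h2j : (2 : ℚ) ^ (N ! * j) ≠ 0 := pow_ne_zero _ two_ne_zero
    rw [h2, div_pow, ← pow_mul]
    field_simp
  have hc2 : ∑ j ∈ Finset.range (k + 1),
      (p : PadicAlgCl 2) ^ j * 2 ^ ((k - j) * N !) * aeval (r : PadicAlgCl 2) (c j) = 0 := by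
    have h : ∀ j, ((aeval r (c j) : ℚ) : PadicAlgCl 2) = aeval (r : PadicAlgCl 2) (c j) :=
      fun j => aeval_ratCast _ _
    simp_rw [← h]
    exact_mod_cast hq1
  rw [Finset.sum_range_succ, Nat.sub_self, zero_mul, pow_zero, mul_one] at hc2
  exact eq_neg_of_add_eq_zero_right hc2

/-- **(α) `top_coeff_small`** — ULTRAMETRIC DOMINATION of the top `x`-power: on the level `x = s_N` (`N ≥ 3`, so that
`p_N` is a 2-adic unit) `‖c_k(r)‖₂ ≤ 2^{−N!} · max(1, ‖r‖₂)^{deg c_k + e}`.  THIS is where `hdeg` (`deg c_j ≤ deg c_k + e`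
for `j < k`) is consumed, and only here: it bounds the lower `x`-powers `‖c_j(r)‖₂ ≤ max(1, ‖r‖₂)^{deg c_j}`. -/
theorem top_coeff_small (k : ℕ) (c : ℕ → ℤ[X]) (e : ℕ)
    (hdeg : ∀ j, j < k → (c j).natDegree ≤ (c k).natDegree + e) {N : ℕ} (hN : 3 ≤ N) (r : ℚ)
    (hP : bev (xPolyP k c) (partialSum 2 N) r = 0) :
    ‖aeval (r : PadicAlgCl 2) (c k)‖ ≤
      (1 / 2 : ℝ) ^ N ! * max 1 ‖(r : PadicAlgCl 2)‖ ^ ((c k).natDegree + e) := by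
  have htop := level_identity k c N r hP
  have hp1 : ‖(psNumer 2 N : PadicAlgCl 2)‖ = 1 := norm_psNumer hN
  set M : ℝ := max 1 ‖(r : PadicAlgCl 2)‖ with hMdef
  have hM1 : 1 ≤ M := le_max_left _ _
  have h1 : ‖(psNumer 2 N : PadicAlgCl 2) ^ k * aeval (r : PadicAlgCl 2) (c k)‖ = ‖aeval (r : PadicAlgCl 2) (c k)‖ := by
    rw [norm_mul, norm_pow, hp1, one_pow, one_mul]
  rw [← h1, htop, norm_neg]
  apply IsUltrametricDist.norm_sum_le_of_forall_le_of_nonneg (by positivity)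
  intro j hj
  have hjk : j < k := Finset.mem_range.mp hj
  rw [norm_mul, norm_mul, norm_pow, hp1, one_pow, one_mul, norm_two_pow]
  have hA : ‖aeval (r : PadicAlgCl 2) (c j)‖ ≤ M ^ ((c k).natDegree + e) :=
    (norm_aeval_le (c j) _).trans (pow_le_pow_right₀ hM1 (hdeg j hjk))
  have h2 : (1 / 2 : ℝ) ^ ((k - j) * N !) ≤ (1 / 2 : ℝ) ^ N ! :=
    pow_le_pow_of_le_one (by norm_num) (by norm_num) (Nat.le_mul_of_pos_left _ (by omega))
  exact mul_le_mul h2 hA (norm_nonneg _) (by positivity)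

/-! ### The dichotomy: near a finite simple point over `x = ∞`, or at the point `(∞, ∞)` -/

set_option maxHeartbeats 400000 in
/-- **near a root of `c_k`, or 2-adically at `(∞, ∞)`**: for `N ≥ N₁` every rational point `r` of level `N` either
is `2^{−N!}`-close in `ℂ₂` to a root `β` of `c_k` (`‖lc·(r − β)‖₂ ≤ c·2^{−N!}`), or satisfies `‖lc‖₂·2^{N!} ≤ ‖r‖₂^e`
with `e ≥ 1`. -/
theorem near_root_or_at_infinity (k : ℕ) (c : ℕ → ℤ[X]) (e : ℕ) (hd : 1 ≤ (c k).natDegree)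
    (hsep : ((c k).map (Int.castRingHom ℚ)).Separable)
    (hdeg : ∀ j, j < k → (c j).natDegree ≤ (c k).natDegree + e) :
    ∃ (T : Finset (PadicAlgCl 2)) (cc : ℝ) (N₁ : ℕ), 0 < cc ∧ (∀ β ∈ T, aeval β (c k) = 0) ∧
      ∀ N, N₁ ≤ N → ∀ r : ℚ, bev (xPolyP k c) (partialSum 2 N) r = 0 →
        (∃ β ∈ T, ‖((c k).leadingCoeff : PadicAlgCl 2) * ((r : PadicAlgCl 2) - β)‖ ≤ cc * (1 / 2 : ℝ) ^ N !) ∨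
        (1 ≤ e ∧ ‖((c k).leadingCoeff : PadicAlgCl 2)‖ * 2 ^ N ! ≤ ‖(r : PadicAlgCl 2)‖ ^ e) := by
  classical
  set B : ℤ[X] := c k with hBdef
  have hB : B ≠ 0 := by rintro h; rw [h] at hd; simp at hd
  obtain ⟨T, c₀, hc₀, hcard, hroots, hprod, hnear⟩ := nearest_root B hd hsep
  set ℓ : PadicAlgCl 2 := (B.leadingCoeff : PadicAlgCl 2) with hℓdef
  have hℓpos : 0 < ‖ℓ‖ := by rw [norm_pos_iff, hℓdef]; exact_mod_cast leadingCoeff_ne_zero.mpr hB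
  have hℓle : ‖ℓ‖ ≤ 1 := norm_intCast_le_one' _
  set R₀ : ℝ := 1 + ∑ β ∈ T, ‖β‖ with hR₀
  have hR₀1 : 1 ≤ R₀ := by
    have : 0 ≤ ∑ β ∈ T, ‖β‖ := Finset.sum_nonneg fun β _ => norm_nonneg β
    linarith
  have hR₀β : ∀ β ∈ T, ‖β‖ < R₀ := by
    intro β hβ
    have := Finset.single_le_sum (f := fun β => ‖β‖) (fun β _ => norm_nonneg β) hβ
    linarith
  obtain ⟨N₁, hN₁⟩ := exists_pow_lt_of_lt_one hℓpos (show (1 / 2 : ℝ) < 1 by norm_num)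
  have hR₀pos : 0 < R₀ := lt_of_lt_of_le one_pos hR₀1
  set d : ℕ := B.natDegree with hddef
  refine ⟨T, c₀ * R₀ ^ (d + e), max N₁ 3, mul_pos hc₀ (pow_pos hR₀pos _), hroots, fun N hN r hP => ?_⟩
  have hN3 : 3 ≤ N := le_trans (le_max_right _ _) hN
  have hNN₁ : N₁ ≤ N := le_trans (le_max_left _ _) hN
  have hdom := top_coeff_small k c e hdeg hN3 r hP
  rw [← hBdef] at hdom
  set M : ℝ := max 1 ‖(r : PadicAlgCl 2)‖ with hMdef
  have hM1 : 1 ≤ M := le_max_left _ _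
  have h2pos : (0 : ℝ) < 2 ^ N ! := by positivity
  have hhalf : (1 / 2 : ℝ) ^ N ! * 2 ^ N ! = 1 := by
    rw [div_pow, one_pow, div_mul_cancel₀ _ (ne_of_gt h2pos)]
  by_cases hrR : ‖(r : PadicAlgCl 2)‖ ≤ R₀
  · -- near a finite root
    left
    have hMR : M ≤ R₀ := max_le hR₀1 hrR
    have hBle : ‖aeval (r : PadicAlgCl 2) B‖ ≤ (1 / 2 : ℝ) ^ N ! * R₀ ^ (d + e) :=
      hdom.trans (mul_le_mul_of_nonneg_left (pow_le_pow_left₀ (zero_le_one.trans hM1) hMR _) (by positivity))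
    obtain ⟨β, hβT, hβ⟩ := hnear (r : PadicAlgCl 2)
    refine ⟨β, hβT, ?_⟩
    rw [norm_mul]
    calc ‖ℓ‖ * ‖(r : PadicAlgCl 2) - β‖ ≤ 1 * (c₀ * ‖aeval (r : PadicAlgCl 2) B‖) := by gcongr
      _ ≤ 1 * (c₀ * ((1 / 2 : ℝ) ^ N ! * R₀ ^ (d + e))) := by gcongr
      _ = c₀ * R₀ ^ (d + e) * (1 / 2 : ℝ) ^ N ! := by ring
  · -- far from all finite roots: the top coefficient is large, so `‖r‖^e` must pay for `2^{N!}`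
    right
    push Not at hrR
    have hr1 : 1 ≤ ‖(r : PadicAlgCl 2)‖ := hR₀1.trans hrR.le
    have hrpos : 0 < ‖(r : PadicAlgCl 2)‖ := lt_of_lt_of_le one_pos hr1
    have hfac : ∀ β ∈ T, ‖(r : PadicAlgCl 2) - β‖ = ‖(r : PadicAlgCl 2)‖ := by
      intro β hβ
      have hne : ‖(r : PadicAlgCl 2)‖ ≠ ‖-β‖ := by
        rw [norm_neg]; exact ne_of_gt ((hR₀β β hβ).trans hrR)
      rw [sub_eq_add_neg, IsUltrametricDist.norm_add_eq_max_of_norm_ne_norm hne, norm_neg]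
      exact max_eq_left ((hR₀β β hβ).trans hrR).le
    have hBn : ‖aeval (r : PadicAlgCl 2) B‖ = ‖ℓ‖ * ‖(r : PadicAlgCl 2)‖ ^ d := by
      rw [hprod, norm_mul, norm_prod, Finset.prod_congr rfl hfac, Finset.prod_const, hcard]
    have hMr : M = ‖(r : PadicAlgCl 2)‖ := max_eq_right hr1
    have h1 : ‖ℓ‖ * ‖(r : PadicAlgCl 2)‖ ^ d ≤
        ((1 / 2 : ℝ) ^ N ! * ‖(r : PadicAlgCl 2)‖ ^ e) * ‖(r : PadicAlgCl 2)‖ ^ d := by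
      rw [← hBn, mul_assoc, ← pow_add, add_comm e d, ← hMr]; exact hdom
    have h2 : ‖ℓ‖ ≤ (1 / 2 : ℝ) ^ N ! * ‖(r : PadicAlgCl 2)‖ ^ e := le_of_mul_le_mul_right h1 (pow_pos hrpos _)
    have h3 : ‖ℓ‖ * 2 ^ N ! ≤ ‖(r : PadicAlgCl 2)‖ ^ e := by
      have := mul_le_mul_of_nonneg_right h2 h2pos.le
      calc ‖ℓ‖ * 2 ^ N ! ≤ (1 / 2 : ℝ) ^ N ! * ‖(r : PadicAlgCl 2)‖ ^ e * 2 ^ N ! := this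
        _ = ‖(r : PadicAlgCl 2)‖ ^ e := by rw [mul_comm, ← mul_assoc, mul_comm (2 ^ N ! : ℝ), hhalf, one_mul]
    refine ⟨?_, h3⟩
    -- `e = 0` is impossible for `N ≥ N₁`
    by_contra he
    have he0 : e = 0 := by omega
    rw [he0, pow_zero] at h2
    have h4 : (1 / 2 : ℝ) ^ N ! ≤ (1 / 2 : ℝ) ^ N₁ :=
      pow_le_pow_of_le_one (by norm_num) (by norm_num) (hNN₁.trans (Nat.self_le_factorial N))
    linarith

end Summit.Schanuel.Schanuel.Theorems.RootDecomp1KXTop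

end
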